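import Mathlib
import Summits.Ventures.HodgeRepro.Tier4.Target
import Summits.Ventures.HodgeRepro.Tier4.Common.TargetBall
import Summits.Ventures.HodgeRepro.Tier4.Common.TargetCalculus
import Summits.Ventures.HodgeRepro.Tier4.Common.TargetJacobian
import Summits.Ventures.HodgeRepro.Tier4.Common.AutForms
import Summits.Ventures.HodgeRepro.Tier4.Line3.BallChangeOfVariables
import Summits.Ventures.HodgeRepro.Tier4.Line3.DomainTransfer

/-!
# Tier4/Line4/DomainUnfold — the integral of a `Γ′`-invariant density over a measurable fundamental domain equals
its integral against a partition function on the ball (SUPPORT for L4.0′ `pair11_descends`, V2)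

Blind re-derivation cell `pub-hodge-repro`, Tier 4 (README §9–§10), seat t4-L4-p2 (prover, LINE L4, gen 0).  Tree path
`lean/Summits/Ventures/HodgeRepro/Tier4/Line4/DomainUnfold.lean`.  Imports, BY NAME, t4-L3-p1's `Line3/BallChangeOfVariables`
(p663227: `det_restrictScalars_fderiv`, `actM_injOn_ball`) and `Line3/DomainTransfer` (`integral_ball_eq_tsum_domain`,
`ball_ae_eq_iUnion_image`, `measurableSet_image_actM`, `exists_unitaryJ_of_mem_ballActions`, `countable_ballActions`,
`image_subset_ball`) — the tiling of the ball by the translates of a fundamental domain and the change of variables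
`∫_{φ(D)} g = ∫_D |det Jac φ|² · g ∘ φ`, shared between the lines.

WHAT IS PROVED.  `setIntegral_domain_eq_integral_mul_partition`: let `f` be a `Γ′`-INVARIANT DENSITY on the ball
(`|det Jac φ (z)|² · f (φ z) = f z` for every `φ ∈ ballActions τ₀ C Γ′`, `z ∈ ball`) continuous on the ball, `D` a
measurable fundamental domain (the frozen `IsFundamentalDomainFor`), and `χ` a PARTITION FUNCTION of the tiling
(continuous, `≥ 0`, vanishing off a compact `K ⊆ ball`, with `Σ_φ χ (φ z) = 1` on the ball); then `f` is integrable
on `D` and `∫_D f = ∫_ball χ · f`.  This is the unfolding `∫_D f = Σ_φ ∫_D χ(φ z) f(z) dz = Σ_φ ∫_{φ(D)} χ f = ∫_ball χ f`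
(tiling + change of variables + invariance of the density; the interchange of `Σ_φ` and `∫_D` by Mathlib's
`integral_tsum_of_summable_integral_norm`, the summability from the same tiling applied to `|χ f|`).  In particular
(`setIntegral_domain_eq_of_invariant`) the integral of an invariant density over a fundamental domain does not
depend on the domain — the hypothesis `hind` of the skeleton's `costume_of_conclusion`, for densities of this kind.
The partition function itself (from the cocompactness and proper discontinuity of `Γ′`, LitCompactness) is a
separate module.

Nothing here says anything about the status of the Hodge conjecture for CM abelian varieties, which is NOT proved
(HC_CM is NOT proved by anyone in this repository).
-/

set_option autoImplicit false

noncomputable section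

open Matrix MeasureTheory NumberField Topology
open scoped ComplexConjugate

namespace Summit.Ventures.HodgeRepro.Tier4.Line4

open Summit.Ventures.HodgeRepro.Tier4 Summit.Ventures.HodgeRepro.Tier4.Line3

/-! ## 1. Real-valued change of variables and the `HasSum` form of the tiling -/

section Image

variable {M : Matrix (Fin 3) (Fin 3) ℂ}

/-- Change of variables on a measurable `D ⊆ 𝔹` for a real-valued integrand (`M ∈ U(2,1)`). -/
theorem setIntegral_image_actM_real (hM : Mᴴ * J * M = J) {D : Set (Fin 2 → ℂ)} (hD : MeasurableSet D)
    (hDb : D ⊆ ball) (g : (Fin 2 → ℂ) → ℝ) :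
    ∫ w in actM M '' D, g w = ∫ z in D, Complex.normSq (jacDetMap (actM M) z) * g (actM M z) := by
  have hdiff : ∀ z ∈ D, DifferentiableAt ℂ (actM M) z := fun z hz =>
    (differentiableOn_actM hM).differentiableAt (isOpen_ball.mem_nhds (hDb hz))
  have hf' : ∀ z ∈ D, HasFDerivWithinAt (actM M) ((fderiv ℂ (actM M) z).restrictScalars ℝ) D z :=
    fun z hz => ((hdiff z hz).hasFDerivAt.restrictScalars ℝ).hasFDerivWithinAt
  rw [integral_image_eq_integral_abs_det_fderiv_smul (μ := volume) hD hf' ((actM_injOn_ball hM).mono hDb) g]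
  refine setIntegral_congr_fun hD fun z hz => ?_
  rw [det_restrictScalars_fderiv (hdiff z hz), abs_of_nonneg (Complex.normSq_nonneg _), smul_eq_mul]

/-- Integrability on a tile `φ(D)` is integrability of the pulled-back density on `D` (`M ∈ U(2,1)`). -/
theorem integrableOn_image_actM_iff (hM : Mᴴ * J * M = J) {D : Set (Fin 2 → ℂ)} (hD : MeasurableSet D)
    (hDb : D ⊆ ball) (g : (Fin 2 → ℂ) → ℂ) :
    IntegrableOn g (actM M '' D) ↔
      IntegrableOn (fun z => (Complex.normSq (jacDetMap (actM M) z) : ℂ) * g (actM M z)) D := by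
  have hdiff : ∀ z ∈ D, DifferentiableAt ℂ (actM M) z := fun z hz =>
    (differentiableOn_actM hM).differentiableAt (isOpen_ball.mem_nhds (hDb hz))
  have hf' : ∀ z ∈ D, HasFDerivWithinAt (actM M) ((fderiv ℂ (actM M) z).restrictScalars ℝ) D z :=
    fun z hz => ((hdiff z hz).hasFDerivAt.restrictScalars ℝ).hasFDerivWithinAt
  rw [integrableOn_image_iff_integrableOn_abs_det_fderiv_smul (μ := volume) hD hf'
    ((actM_injOn_ball hM).mono hDb) g]
  refine integrableOn_congr_fun (fun z hz => ?_) hD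
  rw [det_restrictScalars_fderiv (hdiff z hz), abs_of_nonneg (Complex.normSq_nonneg _), Complex.real_smul]

end Image

section Tiling

variable {E : Type*} [Field E] [NumberField E] {c : E ≃+* E} {H : Matrix (Fin 3) (Fin 3) E} {τ₀ : E →+* ℂ}
  {C : Matrix (Fin 3) (Fin 3) ℂ} {Γ' : Set (Matrix (Fin 3) (Fin 3) E)}

/-- The tiling of the ball, `HasSum` form, real-valued integrand. -/
theorem hasSum_setIntegral_image_real (hΓ : IsCongruenceSubgroup c H Γ') (hτ : ∀ x, τ₀ (c x) = conj (τ₀ x))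
    (hC : IsSylvester (H.map τ₀) C) {D : Set (Fin 2 → ℂ)} (hD : IsFundamentalDomainFor (ballActions τ₀ C Γ') D)
    {G : (Fin 2 → ℂ) → ℝ} (hG : IntegrableOn G ball) :
    HasSum (fun φ : ballActions τ₀ C Γ' => ∫ z in φ.1 '' D, G z) (∫ z in ball, G z) := by
  haveI : Countable (ballActions τ₀ C Γ') := countable_ballActions
  have hmeas : ∀ φ : ballActions τ₀ C Γ', MeasurableSet (φ.1 '' D) := by
    intro φ
    obtain ⟨M, hM, hφ⟩ := exists_unitaryJ_of_mem_ballActions hΓ hτ hC φ.2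
    rw [hφ]
    exact measurableSet_image_actM hM hD.1 hD.2.1
  have hsub : (⋃ φ : ballActions τ₀ C Γ', φ.1 '' D) ⊆ ball :=
    Set.iUnion_subset fun φ => image_subset_ball hΓ hτ hC φ.2 hD.2.1
  rw [setIntegral_congr_set (ball_ae_eq_iUnion_image hΓ hτ hC hD)]
  refine hasSum_integral_iUnion_ae (fun φ => (hmeas φ).nullMeasurableSet) ?_ (hG.mono_set hsub)
  intro φ ψ hne
  exact hD.2.2.2 φ.1 φ.2 ψ.1 ψ.2 (fun h => hne (Subtype.ext h))

/-- The tiling pulled back to `D`, `HasSum` form, real-valued integrand. -/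
theorem hasSum_setIntegral_domain_real (hΓ : IsCongruenceSubgroup c H Γ') (hτ : ∀ x, τ₀ (c x) = conj (τ₀ x))
    (hC : IsSylvester (H.map τ₀) C) {D : Set (Fin 2 → ℂ)} (hD : IsFundamentalDomainFor (ballActions τ₀ C Γ') D)
    {G : (Fin 2 → ℂ) → ℝ} (hG : IntegrableOn G ball) :
    HasSum (fun φ : ballActions τ₀ C Γ' => ∫ z in D, Complex.normSq (jacDetMap φ.1 z) * G (φ.1 z))
      (∫ z in ball, G z) := by
  refine (hasSum_setIntegral_image_real hΓ hτ hC hD hG).congr_fun fun φ => ?_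
  obtain ⟨M, hM, hφ⟩ := exists_unitaryJ_of_mem_ballActions hΓ hτ hC φ.2
  rw [hφ]
  exact (setIntegral_image_actM_real hM hD.1 hD.2.1 G).symm

end Tiling

/-! ## 2. The unfolding: `∫_D f = ∫_𝔹 χ f` for an invariant density `f` and a partition function `χ` -/

section Unfold

variable {E : Type*} [Field E] [NumberField E] {c : E ≃+* E} {H : Matrix (Fin 3) (Fin 3) E} {τ₀ : E →+* ℂ}
  {C : Matrix (Fin 3) (Fin 3) ℂ} {Γ' : Set (Matrix (Fin 3) (Fin 3) E)}

/-- A function continuous on an open `U` and vanishing off a compact `K ⊆ U` is integrable (real-valued). -/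
theorem integrable_of_continuousOn_of_eqOn_zero_real {U K : Set (Fin 2 → ℂ)} (hU : IsOpen U) (hK : IsCompact K)
    (hKU : K ⊆ U) {f : (Fin 2 → ℂ) → ℝ} (hf : ContinuousOn f U) (h0 : ∀ z ∉ K, f z = 0) : Integrable f := by
  have hc : Continuous f := by
    rw [continuous_iff_continuousAt]
    intro z
    by_cases hz : z ∈ U
    · exact hf.continuousAt (hU.mem_nhds hz)
    · have hzK : z ∉ K := fun h => hz (hKU h)
      have h : (fun _ => (0 : ℝ)) =ᶠ[𝓝 z] f := by
        filter_upwards [hK.isClosed.isOpen_compl.mem_nhds hzK] with w hw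
        exact (h0 w hw).symm
      exact continuousAt_const.congr h
  have hs : HasCompactSupport f :=
    HasCompactSupport.of_support_subset_isCompact hK fun z hz => by_contra fun h => hz (h0 z h)
  exact hc.integrable_of_hasCompactSupport hs

/-- **THE UNFOLDING**: for a `Γ′`-invariant density `f` (`|det Jac φ|² · f ∘ φ = f` on the ball) continuous on the ball,
a measurable fundamental domain `D` and a partition function `χ` (continuous, `≥ 0`, vanishing off a compact `K ⊆ ball`,
`Σ_φ χ (φ z) = 1` on the ball): `f` is integrable on `D` and `∫_D f = ∫_𝔹 χ · f`. -/
theorem setIntegral_domain_eq_integral_mul_partition (hΓ : IsCongruenceSubgroup c H Γ')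
    (hτ : ∀ x, τ₀ (c x) = conj (τ₀ x)) (hC : IsSylvester (H.map τ₀) C) {D : Set (Fin 2 → ℂ)}
    (hD : IsFundamentalDomainFor (ballActions τ₀ C Γ') D) {f : (Fin 2 → ℂ) → ℂ} (hf : ContinuousOn f ball)
    (hinv : ∀ φ ∈ ballActions τ₀ C Γ', ∀ z ∈ ball, (Complex.normSq (jacDetMap φ z) : ℂ) * f (φ z) = f z)
    {χ : (Fin 2 → ℂ) → ℝ} (hχ : Continuous χ) (hχ0 : ∀ z, 0 ≤ χ z) {K : Set (Fin 2 → ℂ)} (hK : IsCompact K)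
    (hKb : K ⊆ ball) (hχK : ∀ z ∉ K, χ z = 0)
    (hpart : ∀ z ∈ ball, HasSum (fun φ : ballActions τ₀ C Γ' => χ (φ.1 z)) 1) :
    IntegrableOn f D ∧ ∫ z in D, f z = ∫ z in ball, (χ z : ℂ) * f z := by
  haveI : Countable (ballActions τ₀ C Γ') := countable_ballActions
  have hDb : D ⊆ ball := hD.2.1
  have hDm : MeasurableSet D := hD.1
  -- the compactly supported density `χ · f`
  have hGc : ContinuousOn (fun z => (χ z : ℂ) * f z) ball :=
    (Complex.continuous_ofReal.comp hχ).continuousOn.mul hf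
  have hG0 : ∀ z ∉ K, (χ z : ℂ) * f z = 0 := fun z hz => by simp [hχK z hz]
  have hGint : Integrable (fun z => (χ z : ℂ) * f z) := by
    have hc : Continuous (fun z => (χ z : ℂ) * f z) := by
      rw [continuous_iff_continuousAt]
      intro z
      by_cases hz : z ∈ ball
      · exact hGc.continuousAt (isOpen_ball.mem_nhds hz)
      · have hzK : z ∉ K := fun h => hz (hKb h)
        have h : (fun _ => (0 : ℂ)) =ᶠ[𝓝 z] fun z => (χ z : ℂ) * f z := by
          filter_upwards [hK.isClosed.isOpen_compl.mem_nhds hzK] with w hw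
          exact (hG0 w hw).symm
        exact continuousAt_const.congr h
    exact hc.integrable_of_hasCompactSupport
      (HasCompactSupport.of_support_subset_isCompact hK fun z hz => by_contra fun h => hz (hG0 z h))
  have hNint : Integrable (fun z => ‖(χ z : ℂ) * f z‖) := hGint.norm
  -- on `D`, the pulled-back tile integrand is `χ (φ z) * f z`
  have hFeq : ∀ φ : ballActions τ₀ C Γ', ∀ z ∈ D,
      (Complex.normSq (jacDetMap φ.1 z) : ℂ) * ((χ (φ.1 z) : ℂ) * f (φ.1 z)) = (χ (φ.1 z) : ℂ) * f z := by
    intro φ z hz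
    rw [← hinv φ.1 φ.2 z (hDb hz)]
    ring
  have hNeq : ∀ φ : ballActions τ₀ C Γ', ∀ z ∈ D,
      Complex.normSq (jacDetMap φ.1 z) * ‖(χ (φ.1 z) : ℂ) * f (φ.1 z)‖ = ‖(χ (φ.1 z) : ℂ) * f z‖ := by
    intro φ z hz
    have h := congrArg (fun w : ℂ => ‖w‖) (hFeq φ z hz)
    simp only [norm_mul, Complex.norm_real, Real.norm_eq_abs, abs_of_nonneg (Complex.normSq_nonneg _)] at h
    simp only [norm_mul, Complex.norm_real, Real.norm_eq_abs]
    linarith [h]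
  -- summability of the tile integrals of the norms (tiling for `‖χ f‖`)
  have hsum : Summable fun φ : ballActions τ₀ C Γ' => ∫ z in D, ‖(χ (φ.1 z) : ℂ) * f z‖ := by
    refine (hasSum_setIntegral_domain_real hΓ hτ hC hD hNint.integrableOn).summable.congr fun φ => ?_
    exact setIntegral_congr_fun hDm fun z hz => hNeq φ z hz
  -- integrability of each tile integrand on `D`
  have hFint : ∀ φ : ballActions τ₀ C Γ', IntegrableOn (fun z => (χ (φ.1 z) : ℂ) * f z) D := by
    intro φ
    obtain ⟨M, hM, hφ⟩ := exists_unitaryJ_of_mem_ballActions hΓ hτ hC φ.2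
    have h1 : IntegrableOn (fun z => (χ z : ℂ) * f z) (φ.1 '' D) := hGint.integrableOn
    rw [hφ, integrableOn_image_actM_iff hM hDm hDb] at h1
    refine h1.congr_fun (fun z hz => ?_) hDm
    have h2 := hFeq φ z hz
    rw [hφ] at h2
    show (Complex.normSq (jacDetMap (actM M) z) : ℂ) * ((χ (actM M z) : ℂ) * f (actM M z)) = (χ (φ.1 z) : ℂ) * f z
    rw [hφ]
    exact h2
  -- the interchange of `Σ_φ` and `∫_D`, and the partition of unity
  have hkey : ∑' φ : ballActions τ₀ C Γ', ∫ z in D, (χ (φ.1 z) : ℂ) * f z =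
      ∫ z in D, ∑' φ : ballActions τ₀ C Γ', (χ (φ.1 z) : ℂ) * f z :=
    integral_tsum_of_summable_integral_norm (μ := volume.restrict D) hFint hsum
  have hpart' : ∀ z ∈ D, ∑' φ : ballActions τ₀ C Γ', (χ (φ.1 z) : ℂ) * f z = f z := by
    intro z hz
    rw [tsum_mul_right]
    have h := (hpart z (hDb hz)).tsum_eq
    have h' : ∑' φ : ballActions τ₀ C Γ', (χ (φ.1 z) : ℂ) = 1 := by
      rw [← Complex.ofReal_tsum, h, Complex.ofReal_one]
    rw [h', one_mul]
  have hball : ∫ z in ball, (χ z : ℂ) * f z = ∑' φ : ballActions τ₀ C Γ', ∫ z in D, (χ (φ.1 z) : ℂ) * f z := by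
    rw [integral_ball_eq_tsum_domain hΓ hτ hC hD hGint.integrableOn]
    exact tsum_congr fun φ => setIntegral_congr_fun hDm fun z hz => hFeq φ z hz
  constructor
  · -- integrability of `f` on `D`: `‖f‖ = Σ_φ ‖χ (φ z) f z‖` on `D`, with summable integrals
    have hmeas : AEStronglyMeasurable f (volume.restrict D) :=
      (hf.mono hDb).aestronglyMeasurable hDm
    refine ⟨hmeas, ?_⟩
    have hnorm : ∀ z ∈ D, ‖f z‖ₑ = ∑' φ : ballActions τ₀ C Γ', ‖(χ (φ.1 z) : ℂ) * f z‖ₑ := by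
      intro z hz
      have hs : Summable fun φ : ballActions τ₀ C Γ' => ‖(χ (φ.1 z) : ℂ) * f z‖ := by
        refine ((hpart z (hDb hz)).summable.mul_right ‖f z‖).congr fun φ => ?_
        rw [norm_mul, Complex.norm_real, Real.norm_eq_abs, abs_of_nonneg (hχ0 _)]
      have h1 : ∑' φ : ballActions τ₀ C Γ', ‖(χ (φ.1 z) : ℂ) * f z‖ = ‖f z‖ := by
        have h := (hpart z (hDb hz)).tsum_eq
        calc ∑' φ : ballActions τ₀ C Γ', ‖(χ (φ.1 z) : ℂ) * f z‖
            = ∑' φ : ballActions τ₀ C Γ', χ (φ.1 z) * ‖f z‖ := by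
              refine tsum_congr fun φ => ?_
              rw [norm_mul, Complex.norm_real, Real.norm_eq_abs, abs_of_nonneg (hχ0 _)]
          _ = ‖f z‖ := by rw [tsum_mul_right, h, one_mul]
      rw [← ofReal_norm, ← h1, ENNReal.ofReal_tsum_of_nonneg (fun φ => norm_nonneg _) hs]
      exact tsum_congr fun φ => ofReal_norm _
    have hlin : ∫⁻ z in D, ‖f z‖ₑ = ∑' φ : ballActions τ₀ C Γ', ∫⁻ z in D, ‖(χ (φ.1 z) : ℂ) * f z‖ₑ := by
      rw [← lintegral_tsum fun φ => (hFint φ).aestronglyMeasurable.enorm]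
      exact setLIntegral_congr_fun hDm fun z hz => hnorm z hz
    rw [HasFiniteIntegral, hlin]
    have h2 : ∀ φ : ballActions τ₀ C Γ', ∫⁻ z in D, ‖(χ (φ.1 z) : ℂ) * f z‖ₑ =
        ENNReal.ofReal (∫ z in D, ‖(χ (φ.1 z) : ℂ) * f z‖) := fun φ =>
      (ofReal_integral_norm_eq_lintegral_enorm (hFint φ)).symm
    simp_rw [h2]
    rw [← ENNReal.ofReal_tsum_of_nonneg (fun φ => integral_nonneg fun z => norm_nonneg _) hsum]
    exact ENNReal.ofReal_lt_top
  · rw [hball, hkey]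
    exact setIntegral_congr_fun hDm fun z hz => (hpart' z hz).symm

/-- **Independence of the fundamental domain**: for an invariant density `f` and two measurable fundamental domains
`D`, `D′` (given a partition function), `∫_D f = ∫_{D′} f`. -/
theorem setIntegral_domain_eq_of_invariant (hΓ : IsCongruenceSubgroup c H Γ')
    (hτ : ∀ x, τ₀ (c x) = conj (τ₀ x)) (hC : IsSylvester (H.map τ₀) C) {D D' : Set (Fin 2 → ℂ)}
    (hD : IsFundamentalDomainFor (ballActions τ₀ C Γ') D) (hD' : IsFundamentalDomainFor (ballActions τ₀ C Γ') D')
    {f : (Fin 2 → ℂ) → ℂ} (hf : ContinuousOn f ball)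
    (hinv : ∀ φ ∈ ballActions τ₀ C Γ', ∀ z ∈ ball, (Complex.normSq (jacDetMap φ z) : ℂ) * f (φ z) = f z)
    {χ : (Fin 2 → ℂ) → ℝ} (hχ : Continuous χ) (hχ0 : ∀ z, 0 ≤ χ z) {K : Set (Fin 2 → ℂ)} (hK : IsCompact K)
    (hKb : K ⊆ ball) (hχK : ∀ z ∉ K, χ z = 0)
    (hpart : ∀ z ∈ ball, HasSum (fun φ : ballActions τ₀ C Γ' => χ (φ.1 z)) 1) :
    ∫ z in D, f z = ∫ z in D', f z := by
  rw [(setIntegral_domain_eq_integral_mul_partition hΓ hτ hC hD hf hinv hχ hχ0 hK hKb hχK hpart).2,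
    (setIntegral_domain_eq_integral_mul_partition hΓ hτ hC hD' hf hinv hχ hχ0 hK hKb hχK hpart).2]

end Unfold

end Summit.Ventures.HodgeRepro.Tier4.Line4

end
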